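import Mathlib
import Literature.NumberTheory.LFunctions.FeketePolynomial

/-!
# `FeketeSOS.FeketeNoSparseSplit` (stmt-ValiantsHypothesis-3997), line `cyclic-valuation-dichotomy` — stub `stub_feketeModPOrder`

In characteristic `p` (odd), the reduction `F̄_p = Σ_{m<p} (m|p) X^m` of the Fekete polynomial vanishes at `X = 1`
to order at least `(p-1)/2`: by Euler's criterion `(m|p) ≡ m^{(p-1)/2}`, so `F̄_p = (X·d/dX)^{(p-1)/2} (Σ_{m<p} X^m)`
and `Σ_{m<p} X^m = (X-1)^{p-1}` in characteristic `p`; each application of `X·d/dX` lowers the `(X-1)`-order by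
at most one.  (Equality holds — Mináč–Nguyen–Tân, arXiv:2111.05256 Prop 5.1 — but is not needed by the line.)

Implementation: the Euler operator is the lambda `fun g => X * derivative g`, iterated with `Nat.iterate`;
`fmo_coeff_iterate_XD` computes its coefficients (`coeff n ↦ coeff n * n^j`), `fmo_dvd_iterate_XD` is the
order drop (from Mathlib's `pow_sub_one_dvd_derivative_of_pow_dvd`), `fmo_intCast_legendreSym` is Euler's
criterion transported to `K` along `ZMod.castHom`, `fmo_geom_sum_eq` is `Σ_{m<p} X^m = (X-1)^{p-1}`
(Frobenius + `geom_sum_mul`), and `fmo_map_feketePolynomial_eq` assembles `F̄_p = (X·d/dX)^{p/2} (Σ_{m<p} X^m)`.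
The hypothesis `p ≠ 2` of the registered signature is not needed (`p - 1 - p/2 = (p-1)/2` for every `p`).
-/

namespace Summit.ValiantsHypothesis.ValiantsHypothesis.Theorems.FeketeNoSparseSplitCyclic

open Polynomial
open Literature.NumberTheory.LFunctions

-- `Summit.ValiantsHypothesis.ValiantsHypothesis.…` is the tree's mandated single-conjunct layout (Sub = Summit).
set_option linter.dupNamespace false

section Helpers

variable {K : Type*} [Field K]

/-- The Euler operator `X·d/dX` multiplies the `n`-th coefficient by `n`. [folklore] -/
theorem fmo_coeff_X_mul_derivative (f : K[X]) (n : ℕ) :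
    (X * derivative f).coeff n = f.coeff n * (n : K) := by
  cases n with
  | zero => rw [mul_coeff_zero, coeff_X_zero, zero_mul, Nat.cast_zero, mul_zero]
  | succ n => rw [coeff_X_mul, coeff_derivative, Nat.cast_succ]

/-- The `j`-th iterate of `X·d/dX` multiplies the `n`-th coefficient by `n^j`. [folklore] -/
theorem fmo_coeff_iterate_XD (f : K[X]) (j n : ℕ) :
    ((fun g : K[X] => X * derivative g)^[j] f).coeff n = f.coeff n * (n : K) ^ j := by
  induction j with
  | zero => rw [Function.iterate_zero_apply, pow_zero, mul_one]
  | succ j ih =>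
    rw [Function.iterate_succ_apply']
    show (X * derivative ((fun g : K[X] => X * derivative g)^[j] f)).coeff n = _
    rw [fmo_coeff_X_mul_derivative, ih, pow_succ, mul_assoc]

/-- **Order drop**: `j` applications of `X·d/dX` lower the `(X - c)`-adic order of `(X - c)^N` by at
most `j`. [folklore] -/
theorem fmo_dvd_iterate_XD (c : K) (N j : ℕ) :
    (X - C c) ^ (N - j) ∣ (fun g : K[X] => X * derivative g)^[j] ((X - C c) ^ N) := by
  induction j with
  | zero => rw [Nat.sub_zero, Function.iterate_zero_apply]
  | succ j ih =>
    rw [Function.iterate_succ_apply', Nat.sub_add_eq]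
    exact dvd_mul_of_dvd_right (pow_sub_one_dvd_derivative_of_pow_dvd ih) X

/-- **Euler's criterion in `K`**: `((n|p) : K) = n ^ (p/2)` in a field of characteristic `p`
(Mathlib's `legendreSym.eq_pow` transported along `ZMod p →+* K`). [folklore] -/
theorem fmo_intCast_legendreSym (p : ℕ) [Fact p.Prime] [CharP K p] (n : ℕ) :
    ((legendreSym p n : ℤ) : K) = (n : K) ^ (p / 2) := by
  rw [← map_intCast (ZMod.castHom (dvd_refl p) K) (legendreSym p n), legendreSym.eq_pow, map_pow,
    Int.cast_natCast, map_natCast]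

/-- **`Σ_{m<p} X^m = (X - 1)^{p-1}`** in characteristic `p` (Frobenius `(X-1)^p = X^p - 1` and the
telescoping `(Σ_{m<p} X^m)(X-1) = X^p - 1`). [folklore] -/
theorem fmo_geom_sum_eq (p : ℕ) [Fact p.Prime] [CharP K p] :
    (∑ m ∈ Finset.range p, (X : K[X]) ^ m) = (X - C 1) ^ (p - 1) := by
  have hp : p.Prime := Fact.out
  have hfrob : (X - C (1 : K)) ^ p = X ^ p - 1 := by
    rw [sub_pow_char, ← C_pow, one_pow, C_1]
  apply mul_right_cancel₀ (X_sub_C_ne_zero (1 : K))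
  rw [← pow_succ, Nat.sub_add_cancel hp.one_le, hfrob, C_1, geom_sum_mul]

/-- The reduction of `f_p` to characteristic `p` is non-zero (its coefficient of `X` is `(1|p) = 1`).
[folklore] -/
theorem fmo_map_feketePolynomial_ne_zero (p : ℕ) [Fact p.Prime] :
    (feketePolynomial p).map (Int.castRingHom K) ≠ 0 := fun h => by
  have h1 : ((feketePolynomial p).map (Int.castRingHom K)).coeff 1 = 0 := by rw [h, coeff_zero]
  rw [coeff_map, coeff_feketePolynomial_of_lt p (Fact.out : p.Prime).one_lt, Nat.cast_one,
    legendreSym.at_one, map_one] at h1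
  exact one_ne_zero h1

/-- **`F̄_p = (X·d/dX)^{p/2} (Σ_{m<p} X^m)`** in characteristic `p`, by Euler's criterion coefficientwise.
[folklore] -/
theorem fmo_map_feketePolynomial_eq (p : ℕ) [Fact p.Prime] [CharP K p] :
    (feketePolynomial p).map (Int.castRingHom K)
      = (fun g : K[X] => X * derivative g)^[p / 2] (∑ m ∈ Finset.range p, (X : K[X]) ^ m) := by
  ext n
  rw [fmo_coeff_iterate_XD, coeff_map, coeff_feketePolynomial, finsetSum_coeff]
  simp only [coeff_X_pow, Finset.sum_ite_eq, Finset.mem_range]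
  split_ifs
  · rw [eq_intCast, fmo_intCast_legendreSym, one_mul]
  · rw [map_zero, zero_mul]

end Helpers

/-- **The order of `F̄_p` at `1` is at least `(p-1)/2`** in every field of characteristic `p` (`p` odd).
[folklore] -/
theorem stub_feketeModPOrder :
    ∀ (K : Type) [Field K] (p : ℕ) [Fact p.Prime] [CharP K p], p ≠ 2 →
      (p - 1) / 2 ≤ rootMultiplicity (1 : K) ((feketePolynomial p).map (Int.castRingHom K)) := by
  intro K _ p _ _ _
  rw [le_rootMultiplicity_iff (fmo_map_feketePolynomial_ne_zero p), fmo_map_feketePolynomial_eq p,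
    fmo_geom_sum_eq p]
  have h := fmo_dvd_iterate_XD (1 : K) (p - 1) (p / 2)
  rwa [show p - 1 - p / 2 = (p - 1) / 2 by omega] at h

end Summit.ValiantsHypothesis.ValiantsHypothesis.Theorems.FeketeNoSparseSplitCyclic
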